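import Summits.QuantumFields.BalabanUV.Beta.BoxPoincare
import Summits.QuantumFields.BalabanUV.Beta.TorusBoxProfile

/-!
# Beta / LatticeFaberKrahn — THE FABER–KRAHN INEQUALITY FOR THE FREE LATTICE LAPLACIAN ON THE TORUS: a function supported on a set
# of `#A` sites inside a coordinate window satisfies `Σ f² ≤ 4d·r(r−1)·Σ_bonds (f(b₊) − f(b₋))²` for every tile side `r` with
# `r^d ≥ 4·#A` — i.e. `λ₁^{Dir}(A) ≳ #A^{−2/d}` (MODEL; unit torus `UT N`; first module of the chain «LATTICE-DEGIORGI-MV»)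

WHY (O.2 item (ii-b) of the D4 MODEL programme).  The row owner's census E-an4-141a and road P3's `SubsolutionMeanValue` reduce the
local-regularity datum `hreg` of `MultiscaleSupMember` to ONE binder: the MEAN-VALUE INEQUALITY (MV) for nonnegative sub-solutions of the
free weighted graph Laplacian on torus boxes.  This lineage proves (MV) for CONSTANT weights IN THE KERNEL by De Giorgi's iteration in
its Faber–Krahn form (level truncation × Caccioppoli × Chebyshev × THIS inequality); the Faber–Krahn inequality replaces the Sobolev
inequality and is obtained here WITHOUT isoperimetry, co-area or Loomis–Whitney: TILE the window by cubes of side `r` with `r^d ≥ 4·#supp f`;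
on each tile this lineage's gen-7 `BoxPoincare.sum_sq_le_energy_add_mean` gives `Σ_tile f² ≤ 2d·r(r−1)·E_tile(f) + (2/r^d)(Σ_tile f)²`,
and by Cauchy–Schwarz `(Σ_tile f)² ≤ #supp·Σ_tile f² ≤ (r^d/4)·Σ_tile f²`, so the mean term is absorbed: `Σ_tile f² ≤ 4d·r(r−1)·E_tile(f)`;
summing over the disjoint tiles (whose in-tile bonds are genuine torus bonds) gives the claim.

CONTENT (kernel, 0 sorry).  §1 `shift a w` (the point `a + w` of the torus, coordinatewise mod `N`), `shift_inj`, `up_shift`; §2 the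
tiles `tile a r (z, v) = shift a (r·z + v)` on `Box d n₀ × Box d r`: `tile_injective` (`n₀·r ≤ N_i`), `up_tile` (in-tile forward bonds are
torus bonds), `exists_tile_eq_shift` (the tiles cover the window of side `n₀·r`); §3 the energy transport `energy_tile_le` and the bond count
`sum_tiles_le` (every torus bond carries at most one in-tile bond: `Finset.sum_image`); §4 the per-tile absorption `tile_sum_sq_le`;
§5 **`faberKrahn_window`**: `supp f ⊆` window of side `n₀r` round `a`, `4·#supp f ≤ r^d` ⟹ `Σ_x f(x)² ≤ 4d·r(r−1)·Σ_b (f(btgt b) − f(bsrc b))²`;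
§6 the ball-to-window dictionary `exists_shift_of_dist_le` (`dist(x, x₀) ≤ R` ⟹ `x = (x₀ − R) + w` with `w_i ≤ 2R`; the torus `dist` is the sup of
the circular coordinate distances) and **`faberKrahn_ball`** (`supp f ⊆ {dist(·,x₀) ≤ R}`, `2R + r ≤ N_i`).
(unit `b2b-balaban-beta-d4-p2`, GEN 10, MODEL crew; claim «LATTICE-DEGIORGI-MV» journal l.22396.)

HONEST FRAMING: discharging `BetaPertH` makes Bałaban's UV stability UNCONDITIONAL — NOT the continuum limit, NOT the
Clay problem.  HONEST DEPENDENCY (verbatim): «continuum YM on T⁴ ⇐ BetaPertH ∧ nine spine estimates (0/9 proved);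
BetaPertH ⇐ (D1) ∧ (D4) ∧ CAP+tail; G-an2-4 gates asym, D1 and NE2/3/4.»  THIS MODULE DISCHARGES NOTHING of `BetaPertH`,
asserts NOTHING printed and cites nothing as a fact (ABSOLUTE RULE): [folklore] finite lattice calculus (the tiling proof of the
Faber–Krahn inequality `λ₁(A) ≥ c_d·#A^{−2/d}` on `ℤ^d`; method pointers only: Barlow, *Random Walks and Heat Kernels on Graphs* (2017)
§3.3; Grigor'yan's Faber–Krahn formulation of De Giorgi's iteration).  No class change on row D4 (critical-path width 0; D4 DISCHARGE NO
DATE); NOT BetaPertH, NOT continuum, NOT Clay, NOT summit progress.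
-/

namespace Summit.QuantumFields.BalabanUV.Beta.LatticeFaberKrahn

open Finset Function
open Summit.QuantumFields.BalabanUV.Beta.BoxPoincare (Box bd energy sum_sq_le_energy_add_mean)
open Literature.MathematicalPhysics.QuantumFieldTheory.Balaban1983to89
open Literature.MathematicalPhysics.QuantumFieldTheory.Balaban1983to89.B9Thm37GluePU (bsrc btgt bsrc_apply btgt_apply)
open B4TorusKernel.MultiPeriod (circAbs)
open B5TorusCover (UT)
open B5Leibniz121 (up)
open Summit.QuantumFields.BalabanUV.Beta.TorusBoxProfile (cdist_le_of_dist_le)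

noncomputable section

variable {d : ℕ} {N : Fin d → ℕ} [∀ i, NeZero (N i)]

/-! ## §1 Shifted points `a + w` -/

/-- The torus point `a + w`, coordinatewise modulo the periods. [folklore] -/
def shift (a : UT N) (w : Fin d → ℕ) : UT N :=
  UT.ofSite N fun i => ⟨((UT.toSite N a i : ℕ) + w i) % N i, Nat.mod_lt _ (Nat.pos_of_ne_zero (NeZero.ne _))⟩

/-- Coordinates of `a + w`. [folklore] -/
theorem shift_val (a : UT N) (w : Fin d → ℕ) (i : Fin d) :
    ((UT.toSite N (shift a w) i : Fin (N i)) : ℕ) = ((UT.toSite N a i : ℕ) + w i) % N i := rfl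

/-- `w ↦ a + w` is injective on offsets below the periods. [folklore] -/
theorem shift_inj (a : UT N) {w w' : Fin d → ℕ} (hw : ∀ i, w i < N i) (hw' : ∀ i, w' i < N i)
    (h : shift a w = shift a w') : w = w' := by
  funext i
  have hc : ((UT.toSite N (shift a w) i : Fin (N i)) : ℕ) = ((UT.toSite N (shift a w') i : Fin (N i)) : ℕ) := by rw [h]
  rw [shift_val, shift_val] at hc
  have h1 : w i % N i = w' i % N i := Nat.ModEq.add_left_cancel' _ hc
  rwa [Nat.mod_eq_of_lt (hw i), Nat.mod_eq_of_lt (hw' i)] at h1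

omit [∀ i, NeZero (N i)] in
/-- Two torus points with the same coordinates are equal. [folklore] -/
theorem ext_of_val {x y : UT N} (h : ∀ i, ((UT.toSite N x i : Fin (N i)) : ℕ) = (UT.toSite N y i : ℕ)) : x = y := by
  have hxy : UT.toSite N x = UT.toSite N y := funext fun i => Fin.ext (h i)
  exact hxy

/-- Coordinates of a forward step: `(x + e_μ)_μ = (x_μ + 1) mod N_μ` and the others unchanged. [folklore] -/
theorem up_val (x : UT N) (μ j : Fin d) :
    ((UT.toSite N (up x μ) j : Fin (N j)) : ℕ) = if j = μ then ((UT.toSite N x μ : ℕ) + 1) % N μ else (UT.toSite N x j : ℕ) := by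
  have e : UT.toSite N (up x μ) = Function.update (UT.toSite N x) μ (UT.toSite N x μ + 1) := rfl
  rw [e]
  by_cases hj : j = μ
  · subst hj
    rw [Function.update_self, if_pos rfl, Fin.val_add, Fin.val_one', Nat.add_mod_mod]
  · rw [Function.update_of_ne hj, if_neg hj]

/-- The forward step of a shifted point shifts the offset: `(a + w) + e_i = a + (w + e_i)`. [folklore] -/
theorem up_shift (a : UT N) (w : Fin d → ℕ) (i : Fin d) : up (shift a w) i = shift a (update w i (w i + 1)) := by
  refine ext_of_val fun j => ?_
  simp only [up_val, shift_val]
  by_cases hj : j = i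
  · subst hj
    rw [if_pos rfl, Function.update_self, Nat.mod_add_mod, Nat.add_assoc]
  · rw [if_neg hj, Function.update_of_ne hj]

/-! ## §2 Tiles of side `r` -/

/-- The tile chart: block index `z`, in-block offset `v` ↦ the torus point `a + (r·z + v)`. [folklore] -/
def tile (a : UT N) (r : ℕ) {n₀ : ℕ} (p : Box d n₀ × Box d r) : UT N :=
  shift a fun i => r * (p.1 i : ℕ) + (p.2 i : ℕ)

omit [∀ i, NeZero (N i)] in
/-- The window offsets of a tile point are below `n₀·r`. [folklore] -/
theorem tile_offset_lt (r : ℕ) {n₀ : ℕ} (p : Box d n₀ × Box d r) (i : Fin d) : r * (p.1 i : ℕ) + (p.2 i : ℕ) < n₀ * r := by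
  have hz := (p.1 i).2
  have hv := (p.2 i).2
  calc r * (p.1 i : ℕ) + (p.2 i : ℕ) < r * (p.1 i : ℕ) + r := by omega
    _ = r * ((p.1 i : ℕ) + 1) := by ring
    _ ≤ r * n₀ := Nat.mul_le_mul_left r hz
    _ = n₀ * r := by ring

/-- **The tile chart is injective** when the window fits into the torus (`n₀·r ≤ N_i`). [folklore] -/
theorem tile_injective (a : UT N) {r n₀ : ℕ} (hfit : ∀ i, n₀ * r ≤ N i) : Injective (tile (n₀ := n₀) a r) := by
  intro p q h
  have hw := shift_inj a (fun i => (tile_offset_lt r p i).trans_le (hfit i)) (fun i => (tile_offset_lt r q i).trans_le (hfit i)) h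
  have hr : ∀ i, (p.2 i : ℕ) < r := fun i => (p.2 i).2
  have hr' : ∀ i, (q.2 i : ℕ) < r := fun i => (q.2 i).2
  have hzi : ∀ i, (p.1 i : ℕ) = (q.1 i : ℕ) ∧ (p.2 i : ℕ) = (q.2 i : ℕ) := by
    intro i
    have hi := congrFun hw i
    have hr0 : 0 < r := by have := hr i; omega
    have h1 : (r * (p.1 i : ℕ) + (p.2 i : ℕ)) / r = (p.1 i : ℕ) := by
      rw [Nat.add_comm, Nat.add_mul_div_left _ _ hr0, Nat.div_eq_of_lt (hr i), Nat.zero_add]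
    have h2 : (r * (q.1 i : ℕ) + (q.2 i : ℕ)) / r = (q.1 i : ℕ) := by
      rw [Nat.add_comm, Nat.add_mul_div_left _ _ hr0, Nat.div_eq_of_lt (hr' i), Nat.zero_add]
    have hz : (p.1 i : ℕ) = (q.1 i : ℕ) := by rw [← h1, ← h2, hi]
    refine ⟨hz, ?_⟩
    rw [hz] at hi
    omega
  obtain ⟨z, v⟩ := p
  obtain ⟨z', v'⟩ := q
  simp only [Prod.mk.injEq]
  exact ⟨funext fun i => Fin.ext (hzi i).1, funext fun i => Fin.ext (hzi i).2⟩

/-- **In-tile forward bonds are torus bonds**: `tile(z, v) + e_i = tile(z, v + e_i)` when `v_i + 1 < r`. [folklore] -/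
theorem up_tile (a : UT N) {r n₀ : ℕ} (z : Box d n₀) (v : Box d r) (i : Fin d) (hv : (v i : ℕ) + 1 < r) :
    up (tile a r (z, v)) i = tile a r (z, update v i ⟨(v i : ℕ) + 1, hv⟩) := by
  unfold tile
  rw [up_shift]
  congr 1
  funext j
  by_cases hj : j = i
  · subst hj
    simp only [Function.update_self]
    ring
  · simp only [Function.update_of_ne hj]

/-- **The tiles cover the window**: every offset `w` with `w_i < n₀·r` is `r·z + v` for a tile point. [folklore] -/
theorem exists_tile_eq_shift (a : UT N) {r n₀ : ℕ} (hr : 1 ≤ r) (w : Fin d → ℕ) (hw : ∀ i, w i < n₀ * r) :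
    ∃ p : Box d n₀ × Box d r, tile a r p = shift a w := by
  have hr0 : 0 < r := hr
  refine ⟨(fun i => ⟨w i / r, (Nat.div_lt_iff_lt_mul hr0).mpr (hw i)⟩, fun i => ⟨w i % r, Nat.mod_lt _ hr0⟩), ?_⟩
  unfold tile
  congr 1
  funext i
  simp only
  exact Nat.div_add_mod (w i) r

/-! ## §3 Energy transport and the bond count -/

/-- The in-tile energy of `f ∘ tile(z, ·)` is at most the sum of the squared torus-bond differences of `f` over the bonds issued from
the tile's points (each in-tile forward difference IS such a bond difference; the far-face terms are `0`). [folklore] -/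
theorem energy_tile_le (a : UT N) {r n₀ : ℕ} (f : UT N → ℝ) (z : Box d n₀) :
    energy (fun v : Box d r => f (tile a r (z, v))) ≤
      ∑ v : Box d r, ∑ i : Fin d, (f (btgt (tile a r (z, v), i)) - f (bsrc (tile a r (z, v), i))) ^ 2 := by
  unfold energy
  refine Finset.sum_le_sum fun v _ => Finset.sum_le_sum fun i _ => ?_
  unfold bd
  split_ifs with hv
  · rw [btgt_apply, bsrc_apply, up_tile a z v i hv]
  · rw [zero_pow two_ne_zero]; exact sq_nonneg _

/-- **Every torus bond carries at most one in-tile bond**: summing a nonnegative bond function over the in-tile bonds of all tiles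
gives at most its sum over all torus bonds. [folklore] -/
theorem sum_tiles_le (a : UT N) {r n₀ : ℕ} (hfit : ∀ i, n₀ * r ≤ N i) (g : UT N × Fin d → ℝ) (hg : ∀ b, 0 ≤ g b) :
    ∑ p : Box d n₀ × Box d r, ∑ i : Fin d, g (tile a r p, i) ≤ ∑ b : UT N × Fin d, g b := by
  classical
  have hinj : Injective (fun q : (Box d n₀ × Box d r) × Fin d => (tile a r q.1, q.2)) := by
    intro q q' h
    simp only [Prod.mk.injEq] at h
    exact Prod.ext (tile_injective a hfit h.1) h.2
  calc ∑ p : Box d n₀ × Box d r, ∑ i : Fin d, g (tile a r p, i)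
      = ∑ q : (Box d n₀ × Box d r) × Fin d, g (tile a r q.1, q.2) :=
        (Fintype.sum_prod_type fun q : (Box d n₀ × Box d r) × Fin d => g (tile a r q.1, q.2)).symm
    _ = ∑ b ∈ (univ : Finset ((Box d n₀ × Box d r) × Fin d)).image (fun q => (tile a r q.1, q.2)), g b :=
        (Finset.sum_image fun q _ q' _ h => hinj h).symm
    _ ≤ ∑ b, g b := Finset.sum_le_sum_of_subset_of_nonneg (Finset.subset_univ _) fun b _ _ => hg b

/-! ## §4 The per-tile absorption of the mean -/

omit [∀ i, NeZero (N i)] in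
/-- Cauchy–Schwarz over the support: `(Σ_v F v)² ≤ #{F ≠ 0}·Σ_v F v²`. [folklore] -/
theorem sq_sum_le_card_mul {ι : Type} [Fintype ι] (F : ι → ℝ) :
    (∑ v, F v) ^ 2 ≤ ((univ.filter fun v => F v ≠ 0).card : ℝ) * ∑ v, F v ^ 2 := by
  classical
  set S := univ.filter fun v => F v ≠ 0 with hS
  have hsum : ∑ v, F v = ∑ v ∈ S, F v := by
    rw [hS, Finset.sum_filter]
    exact Finset.sum_congr rfl fun v _ => by split_ifs with h <;> [rfl; (push Not at h; exact h)]
  have hsq : ∑ v ∈ S, F v ^ 2 ≤ ∑ v, F v ^ 2 :=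
    Finset.sum_le_sum_of_subset_of_nonneg (Finset.subset_univ _) fun v _ _ => sq_nonneg _
  have hcs := Finset.sum_mul_sq_le_sq_mul_sq S (fun _ => (1 : ℝ)) F
  simp only [one_pow, one_mul, Finset.sum_const, nsmul_eq_mul, mul_one] at hcs
  rw [hsum]
  exact hcs.trans (mul_le_mul_of_nonneg_left hsq (Nat.cast_nonneg _))

/-- **Per tile**: if `f` vanishes outside a set of `≤ r^d/4` sites, then on every tile
`Σ_v f(tile(z,v))² ≤ 4d·r(r−1)·(in-tile energy)` — the mean term of `sum_sq_le_energy_add_mean` is at most half the mass. [folklore] -/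
theorem tile_sum_sq_le (a : UT N) {r n₀ : ℕ} (hr : 1 ≤ r) (hfit : ∀ i, n₀ * r ≤ N i) (f : UT N → ℝ)
    (hA : 4 * (univ.filter fun x => f x ≠ 0).card ≤ r ^ d) (z : Box d n₀) :
    ∑ v : Box d r, f (tile a r (z, v)) ^ 2 ≤
      4 * ((d : ℝ) * r * ((r : ℝ) - 1)) * ∑ v : Box d r, ∑ i : Fin d, (f (btgt (tile a r (z, v), i)) - f (bsrc (tile a r (z, v), i))) ^ 2 := by
  classical
  set F : Box d r → ℝ := fun v => f (tile a r (z, v)) with hF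
  have hP := sum_sq_le_energy_add_mean F
  have hE := energy_tile_le a (r := r) f z
  have hr0 : (0 : ℝ) < (r : ℝ) ^ d := by positivity
  -- the support of `F` injects into the support of `f`
  have hcard : ((univ.filter fun v => F v ≠ 0).card : ℝ) ≤ ((univ.filter fun x => f x ≠ 0).card : ℝ) := by
    have hsub : (univ.filter fun v => F v ≠ 0).image (fun v => tile a r (z, v)) ⊆ univ.filter fun x => f x ≠ 0 := by
      intro x hx
      rw [Finset.mem_image] at hx
      obtain ⟨v, hv, rfl⟩ := hx
      rw [Finset.mem_filter] at hv ⊢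
      exact ⟨mem_univ _, hv.2⟩
    have hinj : Set.InjOn (fun v : Box d r => tile a r (z, v)) ↑(univ.filter fun v => F v ≠ 0) := by
      intro v _ v' _ h
      have := tile_injective a hfit h
      simpa using this
    have h := Finset.card_le_card hsub
    rw [Finset.card_image_of_injOn hinj] at h
    exact_mod_cast h
  have hA' : 4 * ((univ.filter fun x => f x ≠ 0).card : ℝ) ≤ (r : ℝ) ^ d := by exact_mod_cast hA
  -- the mean term is at most half the mass
  have hmean : 2 / (r : ℝ) ^ d * (∑ v, F v) ^ 2 ≤ (1 / 2) * ∑ v, F v ^ 2 := by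
    have hcs := sq_sum_le_card_mul F
    have hS0 : 0 ≤ ∑ v, F v ^ 2 := Finset.sum_nonneg fun v _ => sq_nonneg _
    calc 2 / (r : ℝ) ^ d * (∑ v, F v) ^ 2 ≤ 2 / (r : ℝ) ^ d * (((univ.filter fun v => F v ≠ 0).card : ℝ) * ∑ v, F v ^ 2) :=
          mul_le_mul_of_nonneg_left hcs (by positivity)
      _ ≤ 2 / (r : ℝ) ^ d * (((r : ℝ) ^ d / 4) * ∑ v, F v ^ 2) := by
          refine mul_le_mul_of_nonneg_left (mul_le_mul_of_nonneg_right ?_ hS0) (by positivity)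
          linarith
      _ = (1 / 2) * ∑ v, F v ^ 2 := by field_simp; ring
  have hdr : 0 ≤ 2 * ((d : ℝ) * r * ((r : ℝ) - 1)) := by
    have : (1 : ℝ) ≤ r := by exact_mod_cast hr
    have : 0 ≤ (r : ℝ) - 1 := by linarith
    positivity
  have hmain : ∑ v, F v ^ 2 ≤ 2 * ((d : ℝ) * r * ((r : ℝ) - 1)) * energy F + (1 / 2) * ∑ v, F v ^ 2 := by linarith
  have hfin : ∑ v, F v ^ 2 ≤ 4 * ((d : ℝ) * r * ((r : ℝ) - 1)) * energy F := by linarith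
  exact hfin.trans (mul_le_mul_of_nonneg_left hE (by linarith))

/-! ## §5 The Faber–Krahn inequality on a window -/

/-- **THE LATTICE FABER–KRAHN INEQUALITY (window form).**  If `f` vanishes outside the window `{a + w : w_i < n₀·r}` (`n₀·r ≤ N_i`,
`r ≥ 1`) and outside a set of at most `r^d/4` sites, then
`Σ_x f(x)² ≤ 4d·r(r−1)·Σ_b (f(btgt b) − f(bsrc b))²` — `λ₁^{Dir}(supp f) ≥ (4d)⁻¹·r⁻²`, i.e. `≳ #supp^{−2/d}` for the best `r`.
[folklore] -/
theorem faberKrahn_window (a : UT N) {r n₀ : ℕ} (hr : 1 ≤ r) (hfit : ∀ i, n₀ * r ≤ N i) (f : UT N → ℝ)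
    (hsupp : ∀ x, f x ≠ 0 → ∃ w : Fin d → ℕ, (∀ i, w i < n₀ * r) ∧ shift a w = x)
    (hA : 4 * (univ.filter fun x => f x ≠ 0).card ≤ r ^ d) :
    ∑ x, f x ^ 2 ≤ 4 * ((d : ℝ) * r * ((r : ℝ) - 1)) * ∑ b : UT N × Fin d, (f (btgt b) - f (bsrc b)) ^ 2 := by
  classical
  have hinj := tile_injective a (r := r) hfit
  -- `f` vanishes off the image of the tile chart
  have hoff : ∀ x, x ∉ (univ : Finset (Box d n₀ × Box d r)).image (tile a r) → f x ^ 2 = 0 := by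
    intro x hx
    by_contra hne
    have hfx : f x ≠ 0 := fun h0 => hne (by rw [h0]; ring)
    obtain ⟨w, hw, hwx⟩ := hsupp x hfx
    obtain ⟨p, hp⟩ := exists_tile_eq_shift a hr w hw
    exact hx (Finset.mem_image.mpr ⟨p, mem_univ _, by rw [hp, hwx]⟩)
  have h1 : ∑ x ∈ (univ : Finset (Box d n₀ × Box d r)).image (tile a r), f x ^ 2 = ∑ p : Box d n₀ × Box d r, f (tile a r p) ^ 2 :=
    Finset.sum_image fun p _ q _ h => hinj h
  have h2 : ∑ x ∈ (univ : Finset (Box d n₀ × Box d r)).image (tile a r), f x ^ 2 = ∑ x, f x ^ 2 :=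
    Finset.sum_subset (Finset.subset_univ _) fun x _ hx => hoff x hx
  have hsum : ∑ x, f x ^ 2 = ∑ p : Box d n₀ × Box d r, f (tile a r p) ^ 2 := h2.symm.trans h1
  have hdr : 0 ≤ 4 * ((d : ℝ) * r * ((r : ℝ) - 1)) := by
    have : (1 : ℝ) ≤ r := by exact_mod_cast hr
    have : 0 ≤ (r : ℝ) - 1 := by linarith
    positivity
  rw [hsum, Fintype.sum_prod_type]
  calc ∑ z : Box d n₀, ∑ v : Box d r, f (tile a r (z, v)) ^ 2
      ≤ ∑ z : Box d n₀, 4 * ((d : ℝ) * r * ((r : ℝ) - 1)) *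
          ∑ v : Box d r, ∑ i : Fin d, (f (btgt (tile a r (z, v), i)) - f (bsrc (tile a r (z, v), i))) ^ 2 :=
        Finset.sum_le_sum fun z _ => tile_sum_sq_le a hr hfit f hA z
    _ = 4 * ((d : ℝ) * r * ((r : ℝ) - 1)) *
          ∑ p : Box d n₀ × Box d r, ∑ i : Fin d, (f (btgt (tile a r p, i)) - f (bsrc (tile a r p, i))) ^ 2 := by
        rw [← Finset.mul_sum, Fintype.sum_prod_type]
    _ ≤ 4 * ((d : ℝ) * r * ((r : ℝ) - 1)) * ∑ b : UT N × Fin d, (f (btgt b) - f (bsrc b)) ^ 2 :=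
        mul_le_mul_of_nonneg_left (sum_tiles_le a hfit (fun b => (f (btgt b) - f (bsrc b)) ^ 2) fun b => sq_nonneg _) hdr

/-! ## §6 Balls are windows; the Faber–Krahn inequality on a ball -/

/-- The lower corner `x₀ − R` of the ball of radius `R < N_i` round `x₀`. [folklore] -/
def corner (x₀ : UT N) (R : ℕ) : UT N := shift x₀ fun i => N i - R

/-- One coordinate of the ball-to-window dictionary: from `dist(ξ − c, nℤ) ≤ R` (`ξ, c, R < n`) an offset `w ≤ 2R` with
`(c + (n − R) + w) mod n = ξ` (the centred representative of `ξ − c` shifted by `R`). [folklore] -/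
theorem exists_offset_of_circAbs_le {n : ℕ} {ξ c R : ℕ} (hξ : ξ < n) (hR : R < n)
    (hc : circAbs n ((ξ : ℤ) - (c : ℤ)) ≤ R) : ∃ w : ℕ, w ≤ 2 * R ∧ (c + (n - R) + w) % n = ξ := by
  have hn0 : (0 : ℤ) < (n : ℤ) := by exact_mod_cast (show 0 < n by omega)
  set u : ℤ := ((ξ : ℤ) - (c : ℤ)) % (n : ℤ) with hu
  have hu0 : 0 ≤ u := Int.emod_nonneg _ hn0.ne'
  have hun : u < n := Int.emod_lt_of_pos _ hn0
  have hcirc : circAbs n ((ξ : ℤ) - (c : ℤ)) = min u ((n : ℤ) - u) := rfl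
  rw [hcirc] at hc
  -- centred representative `t`, `-R ≤ t ≤ R`, `t ≡ ξ - c (mod n)`
  obtain ⟨t, htR, htR', htmod⟩ : ∃ t : ℤ, -(R : ℤ) ≤ t ∧ t ≤ R ∧ t % (n : ℤ) = u := by
    by_cases h : u ≤ R
    · exact ⟨u, by linarith, h, by rw [hu, Int.emod_emod_of_dvd _ (dvd_refl _)]⟩
    · have h2 : (n : ℤ) - u ≤ R := by
        rcases min_choice u ((n : ℤ) - u) with hm | hm
        · rw [hm] at hc; exact absurd hc h
        · rw [hm] at hc; exact hc
      refine ⟨u - n, by linarith, by linarith, ?_⟩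
      rw [Int.sub_emod, Int.emod_self, sub_zero, hu, Int.emod_emod_of_dvd _ (dvd_refl _),
        Int.emod_emod_of_dvd _ (dvd_refl _)]
  refine ⟨(t + R).toNat, ?_, ?_⟩
  · have h1 : ((t + R).toNat : ℤ) ≤ 2 * R := by rw [Int.toNat_of_nonneg (by linarith)]; linarith
    exact_mod_cast h1
  · have hRle : R ≤ n := hR.le
    have hgoal : (((c + (n - R) + (t + R).toNat : ℕ) : ℤ)) % (n : ℤ) = (ξ : ℤ) := by
      have hcast : ((c + (n - R) + (t + R).toNat : ℕ) : ℤ) = ((c : ℤ) + t) + (n : ℤ) * 1 := by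
        push_cast [Nat.cast_sub hRle, Int.toNat_of_nonneg (show 0 ≤ t + R by linarith)]
        ring
      rw [hcast, Int.add_mul_emod_self_left]
      have h1 : ((c : ℤ) + t) % (n : ℤ) = ((c : ℤ) + ((ξ : ℤ) - c)) % (n : ℤ) := by
        rw [Int.add_emod, htmod, hu, ← Int.add_emod]
      rw [h1, show (c : ℤ) + ((ξ : ℤ) - c) = ξ by ring]
      exact Int.emod_eq_of_lt (by exact_mod_cast Nat.zero_le ξ) (by exact_mod_cast hξ)
    have h2 : (((c + (n - R) + (t + R).toNat) % n : ℕ) : ℤ) = (ξ : ℤ) := by rw [Int.natCast_mod]; exact hgoal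
    exact_mod_cast h2

/-- **A ball is a window**: `dist(x, x₀) ≤ R` with `R < N_i` ⟹ `x = (x₀ − R) + w` with every `w_i ≤ 2R` (the torus distance is the
supremum of the circular coordinate distances). [folklore] -/
theorem exists_shift_of_dist_le (x₀ : UT N) {R : ℕ} (hR : ∀ i, R < N i) {x : UT N} (hx : dist x x₀ ≤ R) :
    ∃ w : Fin d → ℕ, (∀ i, w i ≤ 2 * R) ∧ shift (corner x₀ R) w = x := by
  have key : ∀ i, ∃ wi : ℕ, wi ≤ 2 * R ∧ ((UT.toSite N x₀ i : ℕ) + (N i - R) + wi) % N i = (UT.toSite N x i : ℕ) :=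
    fun i => exists_offset_of_circAbs_le (UT.toSite N x i).2 (hR i) (cdist_le_of_dist_le hx i)
  choose w hw hwx using key
  refine ⟨w, hw, ext_of_val fun i => ?_⟩
  rw [shift_val, corner, shift_val, Nat.mod_add_mod]
  exact hwx i

/-- **THE LATTICE FABER–KRAHN INEQUALITY (ball form).**  If `f` vanishes outside the ball `dist(·, x₀) ≤ R` and outside a set of at most
`r^d/4` sites, `r ≥ 1`, `2R + r ≤ N_i`, then `Σ_x f(x)² ≤ 4d·r(r−1)·Σ_b (f(btgt b) − f(bsrc b))²`. [folklore] -/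
theorem faberKrahn_ball (x₀ : UT N) (R : ℕ) {r : ℕ} (hr : 1 ≤ r) (hN : ∀ i, 2 * R + r ≤ N i) (f : UT N → ℝ)
    (hsupp : ∀ x, f x ≠ 0 → dist x x₀ ≤ R) (hA : 4 * (univ.filter fun x => f x ≠ 0).card ≤ r ^ d) :
    ∑ x, f x ^ 2 ≤ 4 * ((d : ℝ) * r * ((r : ℝ) - 1)) * ∑ b : UT N × Fin d, (f (btgt b) - f (bsrc b)) ^ 2 := by
  -- window of `n₀ = ⌈(2R+1)/r⌉` tiles round the corner
  set n₀ : ℕ := (2 * R + r) / r with hn₀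
  have hr0 : 0 < r := hr
  have hfit : ∀ i, n₀ * r ≤ N i := fun i => (Nat.div_mul_le_self _ _).trans (hN i)
  have hcov : 2 * R + 1 ≤ n₀ * r := by
    have h1 : (2 * R + r) / r * r + (2 * R + r) % r = 2 * R + r := Nat.div_add_mod' _ _
    have h2 : (2 * R + r) % r < r := Nat.mod_lt _ hr0
    rw [hn₀]; omega
  have hRN : ∀ i, R < N i := fun i => by have := hN i; omega
  refine faberKrahn_window (corner x₀ R) hr hfit f (fun x hx => ?_) hA
  obtain ⟨w, hw, hwx⟩ := exists_shift_of_dist_le x₀ hRN (hsupp x hx)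
  exact ⟨w, fun i => by have := hw i; omega, hwx⟩

end

end Summit.QuantumFields.BalabanUV.Beta.LatticeFaberKrahn
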